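import Summits.HubbardSuperconductivity.HubbardSuperconductivity.Theorems.AnisotropyChordTransferFibre3DyadicRate

/-!
# Route `AnisotropyChord` / H0 rotor rung: ★ ONE ℤ² KERNEL FOR ALL MODULI — identification of the dyadic limits and the uniform periodisation rate `|a^{(L)}_0(r) − a_∞(r)| ≤ 2C₀|r|²/L`

Sixth file of the periodisation toolkit (memo ROTOR-THEORY-21 §320–§322; PartN37 `TorusKernelQuadraticLaw`; the periodisation input
`δper` of `…Fibre3TwoHoleBSTail.dualCert_threeQuarter_of_tail`).  `…Fibre3DyadicRate` gives, for each odd part `M`, a limit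
`aInf M x y` of the chain `a^{(2^k M)}_0(x,y)` with rate `2C₀ρ/(2^k M)`; here the limits of DIFFERENT chains are identified, so that a
single modulus-independent ℤ² kernel `aZ2` serves every `L`:
* ★ `norm_one_sub_mul_norm_sum_le` — complex Abel summation with a character weight (`σ(n+d) = ω σ(n)` ⇒
  `‖1 − ω‖·‖Σ σ F‖ ≤ Σ ‖F(n+d) − F(n)‖`), `aKer_shift_sub` (increment at an arbitrary shift = `Re φ(s)`-weighted sum of the real
  symbol `h_r` + an `Im·Im` part), `rootOf`, `norm_rootOf`, `rootOf_ne_one` (Mathlib `Complex.isPrimitiveRoot_exp`),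
  `sum_im_phase_jshift` (the `Im` parts cancel over cosets), `phase_add_ex_jshift` / `phase_add_ey_jshift` (`ω = exp(2πi j₁/q)`);
* ★ `aKer_red_sub_aKer_eq` — EXACT coset decomposition `a^{(N)}(r mod N) − a^{(qN)}(r) = (1/V) Σ_{j≠0} Σ_n Re φ_n(jN) h_r(n)`;
  `abs_charSum_le`, `cj`, `abs_charSum_le_cj`, `Cq`, `Cq_nonneg`;
* ★★ `abs_aKer_sub_aKer_mul_le` — the GENERAL-`q` COMPARISON `|a^{(N)}_0(x,y) − a^{(qN)}_0(x,y)| ≤ C_q(x²+y²)/N`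
  (`abs_aKer_sub_aKer_of_eq_mul`: fine modulus as a free parameter), `aKer_intCast_congr`, `aInf_congr`;
* ★★ `aInf_eq_aInf_mul` — the chains through `N` and `qN` have the same limit; `aZ2 x y := aInf 1 x y`, `aInf_eq_aZ2`;
* ★★★ `abs_aKer_sub_aZ2_le`: for EVERY `L ≥ 1`, `|a^{(L)}_0(x,y) − aZ2 x y| ≤ 2C₀(x²+y²)/L`, `C₀ = (15/2)(π²/2+π⁴/4) + 3π²/16`.
So the model `A_m := 2·aZ2` in the tail certificate has periodisation error `δper ≤ 4C₀ρ_max/L` — existence of the infinite-volume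
kernel with a quantified, modulus-uniform rate and NO continuum integral (constants crude: the true law is `|r|²/(4V)`, memo §322).
Prover seat `hubbard-h0-rotor-p2` g2; helper for stmt-HubbardSuperconductivity-19089 (`--supports`, helper class).
WHAT THIS IS NOT: nothing here proves superconductivity in the Hubbard model; the rotor TARGET as originally worded stays
FALSE (g15 verdict).  A convergence statement behind ONE analytic input (periodisation) of ONE input (HOLE₂) of ONE conditional
reduction (rung 19089).  Mathlib + tree imports only; no sorry, no axioms.
-/

set_option linter.dupNamespace false

noncomputable section

open scoped BigOperators
open Complex Finset

namespace Summit.HubbardSuperconductivity.HubbardSuperconductivity.Theorems.AnisotropyChord.Transfer.Fibre3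

namespace Subsample

/-! ## Identification of the dyadic limits across chains: the general-`q` comparison `a^{(N)}_0(r) − a^{(qN)}_0(r) = O_q(|r|²/N)` -/

section Chain

open Filter Topology

/-- ★ complex Abel summation with a character weight: if `σ(n + d) = ω·σ(n)`, `‖σ(n)‖ ≤ 1` and `‖ω‖ ≤ 1`, then
`‖1 − ω‖·‖Σ_n σ(n) F(n)‖ ≤ Σ_n ‖F(n + d) − F(n)‖` (shift the summation variable by `d`). [folklore] -/
theorem norm_one_sub_mul_norm_sum_le {L : ℕ} [NeZero L] (σ F : Tor L → ℂ) (d : Tor L) (ω : ℂ)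
    (hσ : ∀ n, σ (n + d) = ω * σ n) (hσ1 : ∀ n, ‖σ n‖ ≤ 1) (hω : ‖ω‖ ≤ 1) :
    ‖1 - ω‖ * ‖∑ n : Tor L, σ n * F n‖ ≤ ∑ n : Tor L, ‖F (n + d) - F n‖ := by
  have hshift : ∑ n : Tor L, σ n * F n = ∑ n : Tor L, σ (n + d) * F (n + d) :=
    (Equiv.sum_comp (Equiv.addRight d) (fun n => σ n * F n)).symm
  have hS : ∑ n : Tor L, σ n * F n = ω * ∑ n : Tor L, σ n * F (n + d) := by
    rw [hshift, Finset.mul_sum]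
    refine Finset.sum_congr rfl fun n _ => ?_
    rw [hσ n, mul_assoc]
  have hdiff : ∑ n : Tor L, σ n * (F (n + d) - F n)
      = (∑ n : Tor L, σ n * F (n + d)) - ∑ n : Tor L, σ n * F n := by
    rw [← Finset.sum_sub_distrib]
    refine Finset.sum_congr rfl fun n _ => ?_
    ring
  have hkey : (1 - ω) * ∑ n : Tor L, σ n * F n = ω * ∑ n : Tor L, σ n * (F (n + d) - F n) := by
    rw [hdiff, mul_sub, ← hS]
    ring
  rw [← norm_mul, hkey, norm_mul]
  calc ‖ω‖ * ‖∑ n : Tor L, σ n * (F (n + d) - F n)‖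
      ≤ 1 * ∑ n : Tor L, ‖F (n + d) - F n‖ := by
        refine mul_le_mul hω ?_ (norm_nonneg _) zero_le_one
        refine (norm_sum_le _ _).trans (Finset.sum_le_sum fun n _ => ?_)
        rw [norm_mul]
        calc ‖σ n‖ * ‖F (n + d) - F n‖ ≤ 1 * ‖F (n + d) - F n‖ :=
              mul_le_mul_of_nonneg_right (hσ1 n) (norm_nonneg _)
          _ = _ := one_mul _
    _ = _ := one_mul _

/-- the kernel increment at an arbitrary shift `s`, split into the `Re φ(s)`-weighted sum of the REAL symbol `h_r` and an
`Im φ(r)·Im φ(s)` part: `a(r + s) − a(s) = (1/V)[Σ_n Re φ_n(s)·h_r(n) + Σ_n g(n)·Im φ_n(r)·Im φ_n(s)]`. [folklore] -/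
theorem aKer_shift_sub (L : ℕ) [NeZero L] (r s : Tor L) :
    aKer L 0 (r + s) - aKer L 0 s
      = ((∑ n : Tor L, (phase L n s).re * hfun L r n)
          + ∑ n : Tor L, gres L 0 n * (phase L n r).im * (phase L n s).im) / (L : ℝ) ^ 2 := by
  have h0 : aKer L 0 (r + s) - aKer L 0 s = Gres L 0 s - Gres L 0 (r + s) := by
    unfold aKer; ring
  rw [h0]
  unfold Gres
  rw [← sub_div, ← Finset.sum_sub_distrib, ← Finset.sum_add_distrib]
  congr 1
  refine Finset.sum_congr rfl fun n _ => ?_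
  unfold hfun
  rw [phase_add, Complex.mul_re]
  ring

variable (q : ℕ) [NeZero q] (N : ℕ) [NeZero N]

/-- the `q`-th roots of unity `exp(2πi a/q)`. [folklore] -/
def rootOf (a : ℕ) : ℂ := Complex.exp (2 * Real.pi * Complex.I * ((a : ℂ) / q))

omit [NeZero q] in
/-- `‖exp(2πi a/q)‖ = 1`. [folklore] -/
theorem norm_rootOf (a : ℕ) : ‖rootOf q a‖ = 1 := by
  unfold rootOf
  rw [show (2 * Real.pi * Complex.I * ((a : ℂ) / q) : ℂ) = ((2 * Real.pi * a / q : ℝ) : ℂ) * Complex.I by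
    push_cast; ring]
  exact Complex.norm_exp_ofReal_mul_I _

/-- `exp(2πi a/q) ≠ 1` for `0 < a < q`. [folklore] -/
theorem rootOf_ne_one {a : ℕ} (ha : 0 < a) (haq : a < q) : rootOf q a ≠ 1 := by
  unfold rootOf
  rw [show (2 * Real.pi * Complex.I * ((a : ℂ) / q) : ℂ) = (a : ℕ) * (2 * Real.pi * Complex.I / q) by ring,
    Complex.exp_nat_mul]
  exact (Complex.isPrimitiveRoot_exp q (NeZero.ne q)).pow_ne_one_of_pos_of_lt ha.ne' haq

/-- the coset sum of `Im φ` vanishes: `Σ_{j ∈ (ℤ/q)²} Im φ^{qN}_n(jN) = 0`. [folklore] -/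
theorem sum_im_phase_jshift (n : Tor (q * N)) : ∑ j : Tor q, (phase (q * N) n (jshift N q j)).im = 0 := by
  rw [← Complex.im_sum, sum_phase_jshift]
  split_ifs
  · rw [show ((q : ℂ) ^ 2) = ((q ^ 2 : ℕ) : ℂ) by push_cast; rfl, Complex.natCast_im]
  · rfl

omit [NeZero q] [NeZero N] in
/-- `jshift 0 = 0`. [folklore] -/
theorem jshift_zero : jshift N q (0 : Tor q) = 0 := by
  unfold jshift
  ext <;> simp

/-- the character of a coset shift along `eₓ`: `φ_{n + eₓ}(jN) = exp(2πi j₁/q)·φ_n(jN)`. [folklore] -/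
theorem phase_add_ex_jshift (j : Tor q) (n : Tor (q * N)) :
    phase (q * N) (n + ex (q * N)) (jshift N q j) = rootOf q j.1.val * phase (q * N) n (jshift N q j) := by
  have hω : phase (q * N) (ex (q * N)) (jshift N q j) = rootOf q j.1.val := by
    rw [phase_comm, phase_ex, (jshift_val N q j).1]
    unfold rootOf
    congr 1
    have hN : (N : ℂ) ≠ 0 := by exact_mod_cast NeZero.ne N
    have hq : (q : ℂ) ≠ 0 := by exact_mod_cast NeZero.ne q
    push_cast
    field_simp
  rw [phase_add_left, hω, mul_comm]

/-- the character of a coset shift along `e_y`: `φ_{n + e_y}(jN) = exp(2πi j₂/q)·φ_n(jN)`. [folklore] -/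
theorem phase_add_ey_jshift (j : Tor q) (n : Tor (q * N)) :
    phase (q * N) (n + ey (q * N)) (jshift N q j) = rootOf q j.2.val * phase (q * N) n (jshift N q j) := by
  have hω : phase (q * N) (ey (q * N)) (jshift N q j) = rootOf q j.2.val := by
    rw [phase_comm, phase_ey, (jshift_val N q j).2]
    unfold rootOf
    congr 1
    have hN : (N : ℂ) ≠ 0 := by exact_mod_cast NeZero.ne N
    have hq : (q : ℂ) ≠ 0 := by exact_mod_cast NeZero.ne q
    push_cast
    field_simp
  rw [phase_add_left, hω, mul_comm]

/-- ★ the EXACT coset decomposition at `λ = 0`: `a^{(N)}_0(r mod N) − a^{(qN)}_0(r) = (1/V) Σ_{j ≠ 0} Σ_n Re φ_n(jN)·h_r(n)`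
(the `Im·Im` parts cancel over the cosets, `sum_im_phase_jshift`). [folklore] -/
theorem aKer_red_sub_aKer_eq (r : Tor (q * N)) :
    aKer N 0 (red N q r) - aKer (q * N) 0 r
      = (∑ j ∈ (Finset.univ : Finset (Tor q)).erase 0,
          ∑ n : Tor (q * N), (phase (q * N) n (jshift N q j)).re * hfun (q * N) r n) / ((q * N : ℕ) : ℝ) ^ 2 := by
  have hsub := aKer_subsample N q 0 r
  have hD : ∀ j : Tor q, aKer (q * N) 0 (r + jshift N q j) - aKer (q * N) 0 (jshift N q j)
      = ((∑ n : Tor (q * N), (phase (q * N) n (jshift N q j)).re * hfun (q * N) r n)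
          + ∑ n : Tor (q * N), gres (q * N) 0 n * (phase (q * N) n r).im * (phase (q * N) n (jshift N q j)).im)
          / ((q * N : ℕ) : ℝ) ^ 2 :=
    fun j => aKer_shift_sub (q * N) r (jshift N q j)
  have hB : ∑ j : Tor q, ∑ n : Tor (q * N),
      gres (q * N) 0 n * (phase (q * N) n r).im * (phase (q * N) n (jshift N q j)).im = 0 := by
    rw [Finset.sum_comm]
    refine Finset.sum_eq_zero fun n _ => ?_
    rw [← Finset.mul_sum, sum_im_phase_jshift, mul_zero]
  have hz : aKer (q * N) 0 (0 : Tor (q * N)) = 0 := by unfold aKer; exact sub_self _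
  have h0 : aKer (q * N) 0 r
      = (∑ n : Tor (q * N), (phase (q * N) n (jshift N q 0)).re * hfun (q * N) r n) / ((q * N : ℕ) : ℝ) ^ 2 := by
    have h := aKer_shift_sub (q * N) r 0
    have him : ∑ n : Tor (q * N), gres (q * N) 0 n * (phase (q * N) n r).im * (phase (q * N) n 0).im = 0 :=
      Finset.sum_eq_zero fun n _ => by rw [phase_zero, Complex.one_im, mul_zero]
    rw [add_zero, hz, sub_zero, him, add_zero] at h
    rw [jshift_zero, h]
  rw [hsub, Finset.sum_congr rfl fun j _ => hD j, ← Finset.sum_div, Finset.sum_add_distrib, hB, add_zero, h0,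
    ← sub_div, Finset.sum_erase_eq_sub (Finset.mem_univ _)]

/-- ★ the character-weighted sum of the real symbol is controlled by its first differences:
`‖1 − ω‖·|Σ_n Re φ_n(jN) h_r(n)| ≤ Σ_n |h_r(n + d) − h_r(n)|` whenever `φ_{n+d}(jN) = ω φ_n(jN)`, `‖ω‖ ≤ 1`. [folklore] -/
theorem abs_charSum_le (j : Tor q) (d : Tor (q * N)) (ω : ℂ)
    (hω : ∀ n, phase (q * N) (n + d) (jshift N q j) = ω * phase (q * N) n (jshift N q j)) (hω1 : ‖ω‖ ≤ 1)
    (r : Tor (q * N)) :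
    ‖1 - ω‖ * |∑ n : Tor (q * N), (phase (q * N) n (jshift N q j)).re * hfun (q * N) r n|
      ≤ ∑ n : Tor (q * N), |hfun (q * N) r (n + d) - hfun (q * N) r n| := by
  have h := norm_one_sub_mul_norm_sum_le (fun n => phase (q * N) n (jshift N q j))
    (fun n => ((hfun (q * N) r n : ℝ) : ℂ)) d ω hω (fun n => (norm_phase _ _ _).le) hω1
  beta_reduce at h
  have hre : (∑ n : Tor (q * N), (phase (q * N) n (jshift N q j)).re * hfun (q * N) r n)
      = (∑ n : Tor (q * N), phase (q * N) n (jshift N q j) * ((hfun (q * N) r n : ℝ) : ℂ)).re := by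
    rw [Complex.re_sum]
    refine Finset.sum_congr rfl fun n _ => ?_
    rw [Complex.mul_re, Complex.ofReal_re, Complex.ofReal_im, mul_zero, sub_zero]
  have hF : ∑ n : Tor (q * N), ‖((hfun (q * N) r (n + d) : ℝ) : ℂ) - ((hfun (q * N) r n : ℝ) : ℂ)‖
      = ∑ n : Tor (q * N), |hfun (q * N) r (n + d) - hfun (q * N) r n| := by
    refine Finset.sum_congr rfl fun n _ => ?_
    rw [← Complex.ofReal_sub, Complex.norm_real, Real.norm_eq_abs]
  rw [hre, ← hF]
  calc ‖1 - ω‖ * |(∑ n : Tor (q * N), phase (q * N) n (jshift N q j) * ((hfun (q * N) r n : ℝ) : ℂ)).re|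
      ≤ ‖1 - ω‖ * ‖∑ n : Tor (q * N), phase (q * N) n (jshift N q j) * ((hfun (q * N) r n : ℝ) : ℂ)‖ :=
        mul_le_mul_of_nonneg_left (Complex.abs_re_le_norm _) (norm_nonneg _)
    _ ≤ _ := h

/-- the per-coset constant `1/‖1 − ω_j‖` (direction `eₓ` if `j₁ ≠ 0`, else `e_y`); depends on `q` and `j` only. [folklore] -/
def cj (j : Tor q) : ℝ := if j.1 = 0 then ‖1 - rootOf q j.2.val‖⁻¹ else ‖1 - rootOf q j.1.val‖⁻¹

omit [NeZero q] in
/-- `0 ≤ cj`. [folklore] -/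
theorem cj_nonneg (j : Tor q) : 0 ≤ cj q j := by
  unfold cj; split_ifs <;> exact inv_nonneg.mpr (norm_nonneg _)

/-- ★ per-coset bound: for `j ≠ 0`, `|Σ_n Re φ_n(jN) h_r(n)| ≤ cj(j)·(T_{eₓ}(r) + T_{e_y}(r))`. [folklore] -/
theorem abs_charSum_le_cj {j : Tor q} (hj : j ≠ 0) (r : Tor (q * N)) :
    |∑ n : Tor (q * N), (phase (q * N) n (jshift N q j)).re * hfun (q * N) r n|
      ≤ cj q j * ((∑ n : Tor (q * N), |hfun (q * N) r (n + ex (q * N)) - hfun (q * N) r n|)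
          + ∑ n : Tor (q * N), |hfun (q * N) r (n + ey (q * N)) - hfun (q * N) r n|) := by
  have hTx : 0 ≤ ∑ n : Tor (q * N), |hfun (q * N) r (n + ex (q * N)) - hfun (q * N) r n| :=
    Finset.sum_nonneg fun n _ => abs_nonneg _
  have hTy : 0 ≤ ∑ n : Tor (q * N), |hfun (q * N) r (n + ey (q * N)) - hfun (q * N) r n| :=
    Finset.sum_nonneg fun n _ => abs_nonneg _
  unfold cj
  split_ifs with h1
  · -- `j₁ = 0`, so `j₂ ≠ 0`: use the direction `e_y`
    have h2 : j.2 ≠ 0 := by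
      intro h2; exact hj (Prod.ext h1 h2)
    have hpos : 0 < j.2.val := Nat.pos_of_ne_zero fun h => h2 ((ZMod.val_eq_zero j.2).mp h)
    have hne := rootOf_ne_one q hpos (ZMod.val_lt j.2)
    have hc : 0 < ‖1 - rootOf q j.2.val‖ := norm_pos_iff.mpr (sub_ne_zero.mpr (Ne.symm hne))
    have hb := abs_charSum_le q N j (ey (q * N)) (rootOf q j.2.val) (phase_add_ey_jshift q N j)
      (norm_rootOf q _).le r
    replace hb := (le_div_iff₀' hc).mpr hb
    rw [← one_div, one_div_mul_eq_div]  -- `‖…‖⁻¹ * T = T / ‖…‖`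
    calc _ ≤ (∑ n : Tor (q * N), |hfun (q * N) r (n + ey (q * N)) - hfun (q * N) r n|) / ‖1 - rootOf q j.2.val‖ := hb
      _ ≤ _ := by gcongr; linarith
  · have hpos : 0 < j.1.val := Nat.pos_of_ne_zero fun h => h1 ((ZMod.val_eq_zero j.1).mp h)
    have hne := rootOf_ne_one q hpos (ZMod.val_lt j.1)
    have hc : 0 < ‖1 - rootOf q j.1.val‖ := norm_pos_iff.mpr (sub_ne_zero.mpr (Ne.symm hne))
    have hb := abs_charSum_le q N j (ex (q * N)) (rootOf q j.1.val) (phase_add_ex_jshift q N j)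
      (norm_rootOf q _).le r
    replace hb := (le_div_iff₀' hc).mpr hb
    rw [← one_div, one_div_mul_eq_div]
    calc _ ≤ (∑ n : Tor (q * N), |hfun (q * N) r (n + ex (q * N)) - hfun (q * N) r n|) / ‖1 - rootOf q j.1.val‖ := hb
      _ ≤ _ := by gcongr; linarith

/-- the constant of the general-`q` comparison (depends on `q` only). [folklore] -/
def Cq : ℝ :=
  (∑ j ∈ (Finset.univ : Finset (Tor q)).erase 0, cj q j)
    * (2 * (10 * (Real.pi ^ 2 / 2 + Real.pi ^ 4 / 4) * q + Real.pi ^ 2 / 2) / (q : ℝ) ^ 2)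

/-- `0 ≤ Cq`. [folklore] -/
theorem Cq_nonneg : 0 ≤ Cq q := by
  unfold Cq
  refine mul_nonneg (Finset.sum_nonneg fun j _ => cj_nonneg q j) ?_
  positivity

/-- ★★ **THE GENERAL-`q` COMPARISON** (`λ = 0`, every `q, N ≥ 1`, every integer separation):
`|a^{(N)}_0(x, y) − a^{(qN)}_0(x, y)| ≤ C_q·(x² + y²)/N` with `C_q` depending on `q` only (coset decomposition
`aKer_red_sub_aKer_eq`, character Abel summation `abs_charSum_le_cj`, summed first differences `sum_abs_hfun_sub_le`). [folklore] -/
theorem abs_aKer_sub_aKer_mul_le (x y : ℤ) :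
    |aKer N 0 (((x : ℤ) : ZMod N), ((y : ℤ) : ZMod N))
        - aKer (q * N) 0 (((x : ℤ) : ZMod (q * N)), ((y : ℤ) : ZMod (q * N)))|
      ≤ Cq q * ((x : ℝ) ^ 2 + (y : ℝ) ^ 2) / N := by
  have hred := red_intCast N q x y
  have heq := aKer_red_sub_aKer_eq q N (((x : ℤ) : ZMod (q * N)), ((y : ℤ) : ZMod (q * N)))
  rw [hred] at heq
  have hV : (0 : ℝ) < ((q * N : ℕ) : ℝ) ^ 2 := by
    have : (0 : ℝ) < ((q * N : ℕ) : ℝ) := by exact_mod_cast Nat.pos_of_ne_zero (NeZero.ne (q * N))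
    positivity
  rw [heq, abs_div, abs_of_pos hV]
  have hTx := sum_abs_hfun_sub_le (q * N) x y
  have hTy : ∑ n : Tor (q * N), |hfun (q * N) (((x : ℤ) : ZMod (q * N)), ((y : ℤ) : ZMod (q * N))) (n + ey (q * N))
      - hfun (q * N) (((x : ℤ) : ZMod (q * N)), ((y : ℤ) : ZMod (q * N))) n|
      ≤ (10 * (Real.pi ^ 2 / 2 + Real.pi ^ 4 / 4) * ((q * N : ℕ) : ℝ) + Real.pi ^ 2 / 2) * ((x : ℝ) ^ 2 + (y : ℝ) ^ 2) := by
    rw [sum_abs_hfun_sub_ey_eq]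
    have := sum_abs_hfun_sub_le (q * N) y x
    have e : ((y : ℝ) ^ 2 + (x : ℝ) ^ 2) = ((x : ℝ) ^ 2 + (y : ℝ) ^ 2) := by ring
    rw [e] at this
    exact this
  set ρ := (x : ℝ) ^ 2 + (y : ℝ) ^ 2 with hρ
  set K := Real.pi ^ 2 / 2 + Real.pi ^ 4 / 4 with hK
  set r : Tor (q * N) := (((x : ℤ) : ZMod (q * N)), ((y : ℤ) : ZMod (q * N))) with hr
  have hρ0 : 0 ≤ ρ := by rw [hρ]; positivity
  have hK0 : 0 ≤ K := by rw [hK]; positivity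
  have hqN : ((q * N : ℕ) : ℝ) = (q : ℝ) * N := by push_cast; ring
  rw [hqN] at hTx hTy ⊢
  have hq : (0 : ℝ) < q := by exact_mod_cast Nat.pos_of_ne_zero (NeZero.ne q)
  have hN : (0 : ℝ) < N := by exact_mod_cast Nat.pos_of_ne_zero (NeZero.ne N)
  have hN1 : (1 : ℝ) ≤ N := by exact_mod_cast Nat.pos_of_ne_zero (NeZero.ne N)
  -- sum of the per-coset bounds
  have hsum : |∑ j ∈ (Finset.univ : Finset (Tor q)).erase 0,
      ∑ n : Tor (q * N), (phase (q * N) n (jshift N q j)).re * hfun (q * N) r n|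
      ≤ (∑ j ∈ (Finset.univ : Finset (Tor q)).erase 0, cj q j) * (2 * ((10 * K * (q * N) + Real.pi ^ 2 / 2) * ρ)) := by
    refine (Finset.abs_sum_le_sum_abs _ _).trans ?_
    rw [Finset.sum_mul]
    refine Finset.sum_le_sum fun j hj => ?_
    have hj0 : j ≠ 0 := (Finset.mem_erase.mp hj).1
    refine (abs_charSum_le_cj q N hj0 r).trans ?_
    refine mul_le_mul_of_nonneg_left ?_ (cj_nonneg q j)
    rw [hr]
    linarith
  have hV' : (0 : ℝ) ≤ ((q : ℝ) * N) ^ 2 := by positivity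
  refine (div_le_div_of_nonneg_right hsum hV').trans ?_
  have hS0 : 0 ≤ ∑ j ∈ (Finset.univ : Finset (Tor q)).erase 0, cj q j := Finset.sum_nonneg fun j _ => cj_nonneg q j
  -- `(10Kq N + π²/2)/(qN)² ≤ (10Kq + π²/2)/(q² N)`
  unfold Cq
  rw [← hK]
  have hineq : (10 * K * (q * N) + Real.pi ^ 2 / 2) ≤ (10 * K * q + Real.pi ^ 2 / 2) * N := by
    have : Real.pi ^ 2 / 2 ≤ Real.pi ^ 2 / 2 * N := le_mul_of_one_le_right (by positivity) hN1
    nlinarith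
  calc (∑ j ∈ (Finset.univ : Finset (Tor q)).erase 0, cj q j) * (2 * ((10 * K * (q * N) + Real.pi ^ 2 / 2) * ρ))
        / ((q : ℝ) * N) ^ 2
      ≤ (∑ j ∈ (Finset.univ : Finset (Tor q)).erase 0, cj q j) * (2 * (((10 * K * q + Real.pi ^ 2 / 2) * N) * ρ))
        / ((q : ℝ) * N) ^ 2 := by gcongr
    _ = _ := by
      field_simp

/-- the general-`q` comparison with the fine modulus as a free parameter (absorbs the cast `N' = qN`). [folklore] -/
theorem abs_aKer_sub_aKer_of_eq_mul {A B : ℕ} [NeZero A] [NeZero B] (h : B = q * A) (x y : ℤ) :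
    |aKer A 0 (((x : ℤ) : ZMod A), ((y : ℤ) : ZMod A)) - aKer B 0 (((x : ℤ) : ZMod B), ((y : ℤ) : ZMod B))|
      ≤ Cq q * ((x : ℝ) ^ 2 + (y : ℝ) ^ 2) / A := by
  subst h
  exact abs_aKer_sub_aKer_mul_le q A x y

/-- cast-invariance of the kernel differences at integer points. [folklore] -/
theorem aKer_intCast_congr {A B : ℕ} [NeZero A] [NeZero B] (h : A = B) (lam : ℝ) (x y : ℤ) :
    aKer A lam (((x : ℤ) : ZMod A), ((y : ℤ) : ZMod A)) = aKer B lam (((x : ℤ) : ZMod B), ((y : ℤ) : ZMod B)) := by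
  subst h
  rfl

/-- cast-invariance of the dyadic limit. [folklore] -/
theorem aInf_congr {A B : ℕ} [NeZero A] [NeZero B] (h : A = B) (x y : ℤ) : aInf A x y = aInf B x y := by
  subst h
  rfl

/-- ★★ **IDENTIFICATION OF THE DYADIC LIMITS:** the chains through `N` and through `qN` have the same limit,
`a_∞^{(N)}(x, y) = a_∞^{(qN)}(x, y)` (the general-`q` comparison along `2^k N ↦ 2^k qN` tends to `0`). [folklore] -/
theorem aInf_eq_aInf_mul (x y : ℤ) : aInf N x y = aInf (q * N) x y := by
  have hM : (N : ℝ) ≠ 0 := by exact_mod_cast (NeZero.ne N)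
  have hbound : ∀ k : ℕ, ‖aDyad N x y k - aDyad (q * N) x y k‖
      ≤ Cq q * ((x : ℝ) ^ 2 + (y : ℝ) ^ 2) / N * (1 / 2 : ℝ) ^ k := by
    intro k
    rw [Real.norm_eq_abs]
    unfold aDyad
    have h := abs_aKer_sub_aKer_of_eq_mul q (A := 2 ^ k * N) (B := 2 ^ k * (q * N)) (by ring) x y
    refine h.trans (le_of_eq ?_)
    have h2 : (2 : ℝ) ^ k ≠ 0 := pow_ne_zero k two_ne_zero
    push_cast
    rw [one_div_pow]
    field_simp
  have hd : Tendsto (fun k => aDyad N x y k - aDyad (q * N) x y k) atTop (𝓝 0) := by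
    refine squeeze_zero_norm hbound ?_
    simpa using (tendsto_pow_atTop_nhds_zero_of_lt_one (r := (1 / 2 : ℝ)) (by norm_num) (by norm_num)).const_mul
      (Cq q * ((x : ℝ) ^ 2 + (y : ℝ) ^ 2) / N)
  have h2 : Tendsto (aDyad (q * N) x y) atTop (𝓝 (aInf N x y - 0)) :=
    ((aDyad_tendsto N x y).sub hd).congr fun k => by ring
  rw [sub_zero] at h2
  exact (tendsto_nhds_unique (aDyad_tendsto (q * N) x y) h2).symm

/-- ★ the ℤ² kernel differences `a_∞(x, y) := lim_k a^{(2^k)}_0(x, y)` (the dyadic limit of the chain through `1`; by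
`aInf_eq_aZ2` every chain has this limit). [folklore] -/
def aZ2 (x y : ℤ) : ℝ := aInf 1 x y

/-- every dyadic chain converges to `aZ2`. [folklore] -/
theorem aInf_eq_aZ2 (x y : ℤ) : aInf N x y = aZ2 x y := by
  unfold aZ2
  rw [aInf_eq_aInf_mul N 1 x y]
  exact (aInf_congr (Nat.mul_one N) x y).symm

/-- ★★★ **THE PERIODISATION RATE, UNIFORM IN THE MODULUS** (`λ = 0`): for EVERY `L ≥ 1` and every integer separation,
`|a^{(L)}_0(x, y) − a_∞(x, y)| ≤ 2C₀·(x² + y²)/L`, `C₀ = (15/2)(π²/2 + π⁴/4) + 3π²/16`, with ONE modulus-independent ℤ² kernel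
`a_∞ = aZ2` — the integral-free existence-with-rate statement behind the periodisation input `δper` of
`…Fibre3TwoHoleBSTail.dualCert_threeQuarter_of_tail` (model `A_m = 2·aZ2`; constants crude, true law `|r|²/(4V)`). [folklore] -/
theorem abs_aKer_sub_aZ2_le (L : ℕ) [NeZero L] (x y : ℤ) :
    |aKer L 0 (((x : ℤ) : ZMod L), ((y : ℤ) : ZMod L)) - aZ2 x y|
      ≤ 2 * ((15 / 2 * (Real.pi ^ 2 / 2 + Real.pi ^ 4 / 4) + 3 * Real.pi ^ 2 / 16) * ((x : ℝ) ^ 2 + (y : ℝ) ^ 2)) / L := by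
  have h := abs_aDyad_sub_aInf_le L x y 0
  have e : aDyad L x y 0 = aKer L 0 (((x : ℤ) : ZMod L), ((y : ℤ) : ZMod L)) := by
    unfold aDyad
    exact aKer_intCast_congr (by ring) 0 x y
  rw [e, aInf_eq_aZ2, pow_zero, one_mul] at h
  exact h

end Chain

end Subsample

end Summit.HubbardSuperconductivity.HubbardSuperconductivity.Theorems.AnisotropyChord.Transfer.Fibre3

end
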